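import Literature.RingTheory.TightClosure.TightClosure
import Literature.AlgebraicGeometry.Resolution.ExcellentRings
import Mathlib.RingTheory.Regular.RegularSequence
import HarnessLib

/-!
# One tightly closed system-of-parameters ideal makes an excellent local ring Cohen–Macaulay and F-rational (Hochster–Huneke 1994, Prop. 6.27 (a))

Topic: `Literature/RingTheory/TightClosure`. ONE NAMED FACT (not proved here), requested with the
definition item `defn-TightClosure` by route `FrobeniusLadder` (Summits/ResolutionOfSingularities),
whose F-rational rung is typed as "every ideal generated by a system of parameters of every local ring
is tightly closed": M. Hochster, C. Huneke, *F-regularity, test elements, and smooth base change*,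
Trans. Amer. Math. Soc. 346 (1994) 1–62 [HochsterHuneke1994], **Proposition 6.27 (a)** (p. 30 of the
materialised text):

> "(6.27) Proposition. Let `R` be a locally excellent Noetherian ring of characteristic `p`.
> (a) If `R` is equidimensional, local and the ideal generated by one system of parameters is
> tightly closed, then `R` is Cohen–Macaulay and F-rational."

Its printed proof needs completely stable weak test elements (§6 of the paper), the passage to the
completion and Thm. 4.2 (c), (d) / Thm. 4.3 (colon capturing, from [HH90, Thm. 7.15]) — none of which
is in the tree; it is therefore vendored as a fact, stated in the tree's vocabulary
(`IsExcellentRing`, `IsSystemOfParameters`, `IsTightlyClosed`, `IsFRational`, regular sequences).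
See the docstring of `HochsterHuneke1994_prop627a` for the exact rendering choices. Related printed
statements NOT vendored here: Thm. 4.2 (b) "an F-rational ring is normal", (c)–(h); Smith 1997
(F-rational ⇒ pseudo-rational); Fedder's criterion for F-injectivity.

## References

* [HochsterHuneke1994] Trans. Amer. Math. Soc. 346 (1994) 1–62, Def. 4.1, Thm. 4.2, Thm. 4.3,
  Prop. 6.27 (doi:10.1090/s0002-9947-1994-1273534-x).
* [FedderWatanabe1989] Def. 1.10 (the recorded notion `IsFRational`).
-/

namespace Literature.RingTheory.TightClosure

open IsLocalRing RingTheory.Sequence Literature.AlgebraicGeometry.Resolution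

/-- NAMED FACT — **Hochster–Huneke 1994, Prop. 6.27 (a)**: *"Let `R` be a locally excellent
Noetherian ring of characteristic `p`. (a) If `R` is equidimensional, local and the ideal generated
by one system of parameters is tightly closed, then `R` is Cohen–Macaulay and F-rational."*
(Printed proof: a completely stable weak test element exists since `R` is excellent, so the s.o.p.
ideal stays tightly closed in `R̂`, which is an equidimensional homomorphic image of a regular ring;
then Thm. 4.2 (c), (d).) Rendering: `R` excellent (`IsExcellentRing`, in particular locally
excellent); *equidimensional* = `dim R/𝔭 = dim R` for every minimal prime `𝔭`; *Cohen–Macaulay* =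
there is an `R`-regular sequence in `𝔪` of length `dim R` (the tree's phrasing, cf.
`Literature.AlgebraicGeometry.Resolution.exists_isRegular_length_eq_ringKrullDim`); the printed
conclusion "F-rational" is in the sense of [HochsterHuneke1994, Def. 4.1] (every parameter ideal
tightly closed), of which the recorded `IsFRational R p` (every ideal generated by a full system of
parameters is tightly closed, [FedderWatanabe1989, Def. 1.10]) is the special case `P = 𝔪`,
`n = dim R`. Users take `(h : HochsterHuneke1994_prop627a)`.
-- TODO(general form): conclusion for ideals generated by PART of a system of parameters
-- (HH94 Thm. 4.3, last sentence) once "part of a s.o.p." has a tree definition.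
[cite: HochsterHuneke1994, Prop. 6.27 (a)] -/
def HochsterHuneke1994_prop627a : Prop :=
  ∀ (p : ℕ) [Fact p.Prime] (R : Type) [CommRing R] [CharP R p] [IsNoetherianRing R]
    [IsLocalRing R], IsExcellentRing R →
    (∀ P ∈ minimalPrimes R, ringKrullDim (R ⧸ P) = ringKrullDim R) →
    ∀ d : ℕ, ringKrullDim R = d →
    (∃ s : Fin d → R, IsSystemOfParameters s ∧ IsTightlyClosed p (Ideal.span (Set.range s))) →
    (∃ rs : List R, IsRegular R rs ∧ (∀ r ∈ rs, r ∈ maximalIdeal R) ∧ rs.length = d) ∧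
      IsFRational R p

/-- From `HochsterHuneke1994_prop627a`: under its hypotheses EVERY system of parameters generates a
tightly closed ideal. [cite: HochsterHuneke1994, Prop. 6.27 (a)] -/
theorem HochsterHuneke1994_prop627a.isFRational (h : HochsterHuneke1994_prop627a) (p : ℕ)
    [Fact p.Prime] (R : Type) [CommRing R] [CharP R p] [IsNoetherianRing R] [IsLocalRing R]
    (hexc : IsExcellentRing R) (heq : ∀ P ∈ minimalPrimes R, ringKrullDim (R ⧸ P) = ringKrullDim R)
    {d : ℕ} {s : Fin d → R} (hs : IsSystemOfParameters s)
    (ht : IsTightlyClosed p (Ideal.span (Set.range s))) : IsFRational R p :=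
  (h p R hexc heq d hs.1 ⟨s, hs, ht⟩).2

/-- From `HochsterHuneke1994_prop627a`: under its hypotheses `R` is Cohen–Macaulay (a regular
sequence in `𝔪` of length `dim R` exists). [cite: HochsterHuneke1994, Prop. 6.27 (a)] -/
theorem HochsterHuneke1994_prop627a.exists_isRegular (h : HochsterHuneke1994_prop627a) (p : ℕ)
    [Fact p.Prime] (R : Type) [CommRing R] [CharP R p] [IsNoetherianRing R] [IsLocalRing R]
    (hexc : IsExcellentRing R) (heq : ∀ P ∈ minimalPrimes R, ringKrullDim (R ⧸ P) = ringKrullDim R)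
    {d : ℕ} {s : Fin d → R} (hs : IsSystemOfParameters s)
    (ht : IsTightlyClosed p (Ideal.span (Set.range s))) :
    ∃ rs : List R, IsRegular R rs ∧ (∀ r ∈ rs, r ∈ maximalIdeal R) ∧ rs.length = d :=
  (h p R hexc heq d hs.1 ⟨s, hs, ht⟩).1

end Literature.RingTheory.TightClosure
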